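import Literature.IUT.HodgeTheaters.InitialThetaDataTorsionCuspModel
import Literature.IUT.HodgeTheaters.InitialThetaDataTorsionMonodromyModelKLevel
import Literature.IUT.HodgeTheaters.PuncturedEllipticCoverings
import HarnessLib

/-!
# [IUTchI] §1 / Def 3.1 (d) / [EtTh] Def 2.1: the `K`-level data of the group-ring two-step model — the finite factor
# `(𝔽_l[E_F[l]] ⋊ E_F[l]) ⋊ {±1}`, the `l` CUSPS `E_F[l]/𝔽_l·g`, their inertia vectors, and the §1 datum `pedOf₃`
# (NV-L5 row «JOINT-NV-CG (l cusps)», part B2; definitions)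

S. Mochizuki, *Inter-universal Teichmüller theory I*, kurims manuscript (May 2020), §1 p. 37 «`ε′, ε″` for the two
cusps of `X̲` that lie over `ε` … the inertia groups of all nonzero cusps … a natural exact sequence `0 → I_{ε′} × I_{ε″}
→ Δ_ε → Δ_E ⊗ (ℤ/lℤ) → 0`», §3 Definition 3.1 (d) p. 62 «`C̲_K` … of type `(1, l-tors)±` … `X̲_K` of type
`(1, l-tors)`», [EtTh] Def 2.1 p. 36 «a quotient onto a free `(ℤ/lℤ)`-module `Q` of rank `1` … the restricted map
`D_x → Q` is trivial. Denote the corresponding covering by `X̲^log → X^log`» — so the cusp of `X` SPLITS into the `l`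
cusps `Q = Δ_X^{ab} ⊗ 𝔽_l / (line) ≅ E_F[l]/𝔽_l·g` of `X̲`, permuted simply transitively by `Gal(X̲/X) ≅ Q` ([IUTchI]
§1 p.37, Def 3.1 (d) p.62) [claim: Mochizuki2012, status: disputed] (D-0012 claim key; series status DISPUTED — a MODEL
of the cell's `π₁`-interface structures; nothing of the series is asserted; no side taken on [IUTchIII] Cor. 3.12).

## WHAT (continuing `InitialThetaDataTorsionCuspModel.lean`; design memo HOME/staging/L5/L5-t8/g7/STEP0-jointNV-CG.md)

* from part B1 (moved here for the 400-line limit): `transl_e`, `PiX_index`/`PiX_isOpen`/`inr_mem_PiX`/`inl_mem_PiX`,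
  the torsion coordinate `tc` with its cocycle formula;
* `DihU := Del ⋊ {±1}` — the finite factor of `Π_{C_K} := G_K × DihU` (a PRODUCT because `G_K` fixes `E_F[l](F̄)`,
  Def 3.1 (c): `outer_eq_one_of_fixesTorsion`); the surjection `proj : DihU ↠ Dih = E_F[l] ⋊ {±1}` onto this lineage's
  gen-6 finite factor (kernel `U`), along which the three subgroups `dX = Del ⋊ 1`, `dC g` (torsion coordinate in the
  line `ℤ·g`), `dXbar g` and their INDEX TABLE (`[DihU : dX] = 2`, `[DihU : dC g] = l`, `[dX : dXbar g] = l`,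
  `[dC g : dXbar g] = 2`, `dC g ⊄ dX`) are PULLED BACK from `InitialThetaDataTorsionMonodromyModelKLevel.lean`;
* the CUSPS `Cusp g := T ⧸ ℤ·g` (`l` of them) with the AFFINE cusp action `cuspAct : Dih →* Perm (T ⧸ ℤ·g)`,
  `⟨t, u⟩ · q := [t] · q^u` («`Gal(X̲/X) ≅ Q` acts simply transitively; `ι` acts by `−1`»);
* the INERTIA VECTORS `ivec s h q := e_{s(q)·h} − e_{s(q)·h⁻¹} ∈ U` of the cusp `q` (`s` a section of `T ↠ T/ℤ·g`,
  `h` a square root of a fixed `a ∉ ℤ·g`; shifted DIFFERENCES, so that the `l` cusp classes satisfy the single relation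
  `Σ = 0` and `ι` switches `ε′`, `ε″`), the generators `igen` and `liftU`, `extK₃`;
* **`pedOf₃ G g s h a …` — abc-iut-L5-t1's `PuncturedEllipticData` ([IUTchI] §1) on `G × DihU`** for any profinite
  `G` (used with `G := G_K`): `Π_X := G × dX`, `Π_C̲ := G × dC g`, cusps `T ⧸ ℤ·g`, decomposition groups
  `D_q := G × ⟨igen q⟩` (every decomposition group contains `G_K × 1`, as the genuine ones contain a copy of `G_K` — the
  cusps of `X̲_K` are `K`-rational), `ε⁰ := [1]`, `ε′ := [a]`, `ε″ := [a]⁻¹`, `2ε := [a]²`; (∗) `star` holds because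
  commutators of `Π_X` land in `⁅Δ_X, Δ_X⁆`.

HONEST LABEL «[model; `E[l]`-twisted finite shadow `U ⋊ E[l]`; `l` cusps; CG INHABITED (parts B3–B4)]».  Instances only
on this file's own model types.  Model ≠ genuine datum; typed ≠ proved; no side taken on [IUTchIII] Cor. 3.12.
-/

noncomputable section

namespace Literature.IUT.HodgeTheaters

universe u

namespace TorsionCuspModel

open Literature.AnabelianGeometry.AbsoluteAnabelian Topology TorsionMonodromyModel
open Literature.AnabelianGeometry.EtaleTheta.SettingModel
open scoped WeierstrassCurve.Affine Classical

variable {F : Type u} [Field F] (E : WeierstrassCurve F) (Fbar : Type u) [Field Fbar] [Algebra F Fbar] (l : ℕ)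

/-! ## Left over from part B1 -/

/-- Translation moves basis vectors: `P · e_Q = e_{Q P}`. [cite: Mochizuki2012, IUTchI §1 p.37] -/
theorem transl_e (P Q : Tors E Fbar l) : transl E Fbar l P (U.e Q) = U.e (Q * P) := by
  refine U.ext fun R => ?_
  rw [toAdd_transl_apply, U.toAdd_e_apply, U.toAdd_e_apply]
  by_cases h : R = Q * P
  · subst h; rw [if_pos (mul_inv_cancel_right Q P), if_pos rfl]
  · rw [if_neg h, if_neg]
    intro h'
    exact h (by rw [← h', inv_mul_cancel_right])

variable (F)

/-- `[Π_{C_F} : Π_{X_F}] = 2`. [cite: Mochizuki2012, IUTchI Def 3.1 (b) p.61] -/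
theorem PiX_index : (PiX F E Fbar l).index = 2 := by
  rw [PiX, Subgroup.index_ker, MonoidHom.range_eq_top.mpr (sgn_surjective F E Fbar l), Subgroup.card_top,
    Nat.card_eq_fintype_card, Fintype.card_units_int]

/-- `Π_{X_F}` is open. [cite: Mochizuki2012, IUTchI Def 3.1 (b) p.61] -/
theorem PiX_isOpen : IsOpen (PiX F E Fbar l : Set (PiC F E Fbar l)) := by
  have h : (PiX F E Fbar l : Set (PiC F E Fbar l)) = (fun g : PiC F E Fbar l => g.right.2) ⁻¹' {1} := rfl
  rw [h]
  exact (isOpen_discrete _).preimage (continuous_snd.comp (Semidirect.continuous_right (PiC.isInducing F E Fbar l)))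

/-- `inr (σ, 1) ∈ Π_{X_F}`. [cite: Mochizuki2012, IUTchI Def 3.1 (b) p.61] -/
theorem inr_mem_PiX (σ : Fbar ≃ₐ[F] Fbar) : (SemidirectProduct.inr (σ, 1) : PiC F E Fbar l) ∈ PiX F E Fbar l := rfl

/-- `inl d ∈ Π_{X_F}` (`Del ⊆ Δ_X ⊆ Π_X`). [cite: Mochizuki2012, IUTchI Def 3.1 (b) p.61] -/
theorem inl_mem_PiX (d : Del E Fbar l) : (SemidirectProduct.inl d : PiC F E Fbar l) ∈ PiX F E Fbar l := rfl

variable {F E Fbar l}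

/-- The TORSION COORDINATE `tc x := x.left.right ∈ T = E_F[l](F̄)` of `x ∈ Π_{C_F}` (the `E_F[l]`-component of the
geometric part; `τ := pt ∘ tc` is the translation cocycle of `TorsionMonodromy`). [cite: Mochizuki2012, IUTchI Def 6.1 (v) p.158] -/
def tc (x : PiC F E Fbar l) : Tors E Fbar l := x.left.right

/-- **COCYCLE formula**: `tc (x y) = tc x · act(x.right) (tc y)`. [cite: Mochizuki2012, IUTchI Def 6.1 (v) p.158] -/
theorem tc_mul (x y : PiC F E Fbar l) : tc (x * y) = tc x * act F E Fbar l x.right (tc y) := by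
  unfold tc
  rw [SemidirectProduct.mul_left, SemidirectProduct.mul_right, outer_apply_right]

/-- On points: `pt (tc (x y)) = pt (tc x) + u_x • σ_x (pt (tc y))`. [cite: Mochizuki2012, IUTchI Def 6.1 (v) p.158] -/
theorem pt_tc_mul (x y : PiC F E Fbar l) :
    Tors.pt (tc (x * y)) = Tors.pt (tc x) + (x.right.2 : ℤ) • galoisAct E x.right.1 (Tors.pt (tc y)) := by
  rw [tc_mul, Tors.pt_mul, pt_act]

/-- `tc (inl d) = d.right`. [cite: Mochizuki2012, IUTchI Def 6.1 (v) p.158] -/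
@[simp] theorem tc_inl (d : Del E Fbar l) : tc (SemidirectProduct.inl d : PiC F E Fbar l) = d.right := rfl

/-! ## The finite factor `DihU := Del ⋊ {±1}` and its projection onto `Dih = E_F[l] ⋊ {±1}` -/

variable (F E Fbar l)

/-- The action of the involution `{±1}` alone on `Del` (`u ↦ outer (1, u)`). [cite: Mochizuki2012, IUTchI Def 3.1 (d) p.62] -/
def outerK : ℤˣ →* MulAut (Del E Fbar l) := (outer F E Fbar l).comp (MonoidHom.inr (Fbar ≃ₐ[F] Fbar) ℤˣ)

/-- [cite: Mochizuki2012, IUTchI Def 3.1 (d) p.62] -/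
@[simp] theorem outerK_apply (u : ℤˣ) : outerK F E Fbar l u = outer F E Fbar l (1, u) := rfl

/-- **`DihU := (𝔽_l[E_F[l]] ⋊ E_F[l]) ⋊ {±1}`** — the finite factor of the model's `Π_{C_K} := G_K × DihU`; a model type
of this file. [cite: Mochizuki2012, IUTchI Def 3.1 (d) p.62] -/
abbrev DihU : Type u := Del E Fbar l ⋊[outerK F E Fbar l] ℤˣ

namespace DihU

/-- The discrete topology on the finite factor. [folklore] -/
instance instTopologicalSpace : TopologicalSpace (DihU F E Fbar l) := ⊥

/-- The topology is discrete by definition. [folklore] -/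
instance instDiscreteTopology : DiscreteTopology (DihU F E Fbar l) := ⟨rfl⟩

/-- A discrete group is a topological group. [folklore] -/
instance instIsTopologicalGroup : IsTopologicalGroup (DihU F E Fbar l) where
  continuous_mul := continuous_of_discreteTopology
  continuous_inv := continuous_of_discreteTopology

/-- `DihU` is finite. [folklore] -/
instance instFinite [E.IsElliptic] [NeZero l] : Finite (DihU F E Fbar l) :=
  Finite.of_equiv _ SemidirectProduct.equivProd.symm

end DihU

/-- **`proj : DihU ↠ Dih = E_F[l] ⋊ {±1}`**, `⟨⟨f, t⟩, u⟩ ↦ ⟨t, u⟩` (kernel `U`): the finite factor of this lineage's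
gen-6 model is a quotient of the new one. [cite: Mochizuki2012, IUTchI Def 3.1 (d) p.62] -/
def proj : DihU F E Fbar l →* Dih E Fbar l where
  toFun x := ⟨x.left.right, x.right⟩
  map_one' := rfl
  map_mul' x y := by
    refine SemidirectProduct.ext ?_ rfl
    show (x.left * outer F E Fbar l (1, x.right) y.left).right = x.left.right * sgnRep E Fbar l x.right y.left.right
    rw [SemidirectProduct.mul_right, outer_apply_right, act, MonoidHom.noncommCoprod_apply, map_one, one_mul]

/-- [cite: Mochizuki2012, IUTchI Def 3.1 (d) p.62] -/
@[simp] theorem proj_apply_left (x : DihU F E Fbar l) : (proj F E Fbar l x).left = x.left.right := rfl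

/-- [cite: Mochizuki2012, IUTchI Def 3.1 (d) p.62] -/
@[simp] theorem proj_apply_right (x : DihU F E Fbar l) : (proj F E Fbar l x).right = x.right := rfl

/-- `proj` is surjective. [cite: Mochizuki2012, IUTchI Def 3.1 (d) p.62] -/
theorem proj_surjective : Function.Surjective (proj F E Fbar l) :=
  fun d => ⟨⟨⟨1, d.left⟩, d.right⟩, SemidirectProduct.ext rfl rfl⟩

/-! ## The three subgroups `dX`, `dC g`, `dXbar g` of `DihU` and their index table (pulled back along `proj`) -/

/-- `dX := Del ⋊ 1 = proj⁻¹(E_F[l] ⋊ 1)` (so `Π_{X_K} = G_K × dX`). [cite: Mochizuki2012, IUTchI Def 3.1 (d) p.62] -/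
def dX : Subgroup (DihU F E Fbar l) := (Dih.dX F E).comap (proj F E Fbar l)

variable {Fbar l} in
/-- `dC g := proj⁻¹(ℤ·g ⋊ {±1})` (so `Π_{C̲_K} = G_K × dC g`): torsion coordinate in the LINE `ℤ·g`, any sign.
[cite: Mochizuki2012, IUTchI Def 3.1 (d) p.62] -/
def dC (g : Tors E Fbar l) : Subgroup (DihU F E Fbar l) := (Dih.dC F E g).comap (proj F E Fbar l)

variable {Fbar l} in
/-- `dXbar g := dX ⊓ dC g = proj⁻¹(ℤ·g ⋊ 1)` (so `Π_{X̲_K} = G_K × dXbar g`). [cite: Mochizuki2012, IUTchI Def 3.1 (d) p.62] -/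
def dXbar (g : Tors E Fbar l) : Subgroup (DihU F E Fbar l) := dX F E Fbar l ⊓ dC F E g

variable {F E Fbar l}

/-- [cite: Mochizuki2012, IUTchI Def 3.1 (d) p.62] -/
theorem mem_dX_iff (x : DihU F E Fbar l) : x ∈ dX F E Fbar l ↔ x.right = 1 := Iff.rfl

/-- [cite: Mochizuki2012, IUTchI Def 3.1 (d) p.62] -/
theorem mem_dC_iff (g : Tors E Fbar l) (x : DihU F E Fbar l) : x ∈ dC F E g ↔ x.left.right ∈ Subgroup.zpowers g :=
  Iff.rfl

/-- [cite: Mochizuki2012, IUTchI Def 3.1 (d) p.62] -/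
theorem mem_dXbar_iff (g : Tors E Fbar l) (x : DihU F E Fbar l) :
    x ∈ dXbar F E g ↔ x.right = 1 ∧ x.left.right ∈ Subgroup.zpowers g := Iff.rfl

/-- `dXbar g = proj⁻¹(dXbar g)`. [cite: Mochizuki2012, IUTchI Def 3.1 (d) p.62] -/
theorem dXbar_eq_comap (g : Tors E Fbar l) : dXbar F E g = (Dih.dXbar F E g).comap (proj F E Fbar l) := by
  rw [dXbar, Dih.dXbar, Subgroup.comap_inf]; rfl

/-- `[DihU : dX] = 2`. [cite: Mochizuki2012, IUTchI Def 3.1 (d) p.62] -/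
theorem dX_index : (dX F E Fbar l).index = 2 := by
  rw [dX, Subgroup.index_comap_of_surjective _ (proj_surjective F E Fbar l), Dih.dX_index]

/-- `[DihU : dC g] = l` (`l` prime, `#E_F[l](F̄) = l²`, `g ≠ 1`). [cite: Mochizuki2012, IUTchI Def 3.1 (d) p.62] -/
theorem dC_index [E.IsElliptic] [NeZero l] (hl : l.Prime) (hcard : Nat.card (Tors E Fbar l) = l ^ 2) {g : Tors E Fbar l} (hg : g ≠ 1) :
    (dC F E g).index = l := by
  rw [dC, Subgroup.index_comap_of_surjective _ (proj_surjective F E Fbar l), Dih.dC_index hl hcard hg]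

/-- `[dX : dXbar g] = l`: the degree of `X̲_K → X_K`. [cite: Mochizuki2012, IUTchI Def 3.1 (d) p.62] -/
theorem dXbar_relIndex_dX [E.IsElliptic] [NeZero l] (hl : l.Prime) (hcard : Nat.card (Tors E Fbar l) = l ^ 2) {g : Tors E Fbar l} (hg : g ≠ 1) :
    (dXbar F E g).relIndex (dX F E Fbar l) = l := by
  rw [dXbar_eq_comap, dX, Subgroup.relIndex_comap,
    Subgroup.map_comap_eq_self_of_surjective (proj_surjective F E Fbar l), Dih.dXbar_relIndex_dX hl hcard hg]

/-- `[dC g : dXbar g] = 2`: the degree of `X̲_K → C̲_K`. [cite: Mochizuki2012, IUTchI Def 3.1 (d) p.62] -/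
theorem dXbar_relIndex_dC [E.IsElliptic] [NeZero l] (hl : l.Prime) (hcard : Nat.card (Tors E Fbar l) = l ^ 2) {g : Tors E Fbar l} (hg : g ≠ 1) :
    (dXbar F E g).relIndex (dC F E g) = 2 := by
  rw [dXbar_eq_comap, dC, Subgroup.relIndex_comap,
    Subgroup.map_comap_eq_self_of_surjective (proj_surjective F E Fbar l), Dih.dXbar_relIndex_dC hl hcard hg]

/-- `dC g ⊄ dX` (the involution): `C̲_K` is not a covering of `X_K`. [cite: Mochizuki2012, IUTchI Def 3.1 (d) p.62] -/
theorem not_dC_le_dX (g : Tors E Fbar l) : ¬ dC F E g ≤ dX F E Fbar l := by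
  intro h
  apply Dih.not_dC_le_dX (F := F) (E := E) g
  intro d hd
  obtain ⟨x, rfl⟩ := proj_surjective F E Fbar l d
  exact h hd

/-! ## The `l` cusps `T ⧸ ℤ·g` and the affine cusp action of `Dih = E_F[l] ⋊ {±1}` -/

/-- The AFFINE action of `⟨t, u⟩ ∈ E_F[l] ⋊ {±1}` on the cusps `Q = E_F[l]/ℤ·g`: `q ↦ [t] · q^u` («`Gal(X̲/X) ≅ Q`»
translates, `ι` inverts). [cite: Mochizuki2012, IUTchI §1 p.37] -/
def cuspPerm (g : Tors E Fbar l) (d : Dih E Fbar l) : Equiv.Perm (Tors E Fbar l ⧸ Subgroup.zpowers g) where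
  toFun q := (QuotientGroup.mk d.left : Tors E Fbar l ⧸ Subgroup.zpowers g) * q ^ (d.right : ℤ)
  invFun q := ((QuotientGroup.mk d.left : Tors E Fbar l ⧸ Subgroup.zpowers g)⁻¹ * q) ^ (d.right : ℤ)
  left_inv q := by
    simp only [inv_mul_cancel_left, ← zpow_mul, ← Units.val_mul, Int.units_mul_self, Units.val_one, zpow_one]
  right_inv q := by
    simp only [← zpow_mul, ← Units.val_mul, Int.units_mul_self, Units.val_one, zpow_one, mul_inv_cancel_left]

/-- [cite: Mochizuki2012, IUTchI §1 p.37] -/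
@[simp] theorem cuspPerm_apply (g : Tors E Fbar l) (d : Dih E Fbar l) (q : Tors E Fbar l ⧸ Subgroup.zpowers g) :
    cuspPerm g d q = (QuotientGroup.mk d.left : Tors E Fbar l ⧸ Subgroup.zpowers g) * q ^ (d.right : ℤ) := rfl

/-- **The cusp action `Dih = E_F[l] ⋊ {±1} →* Perm (E_F[l]/ℤ·g)`** (a homomorphism: `[t·t'^u]·q^{uu'} = [t]·([t']·q^{u'})^u`).
[cite: Mochizuki2012, IUTchI §1 p.37] -/
def cuspAct (g : Tors E Fbar l) : Dih E Fbar l →* Equiv.Perm (Tors E Fbar l ⧸ Subgroup.zpowers g) where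
  toFun := cuspPerm g
  map_one' := by
    ext q
    rw [cuspPerm_apply, SemidirectProduct.one_left, SemidirectProduct.one_right, QuotientGroup.mk_one, one_mul,
      Units.val_one, zpow_one, Equiv.Perm.one_apply]
  map_mul' d d' := by
    ext q
    rw [Equiv.Perm.mul_apply, cuspPerm_apply, cuspPerm_apply, cuspPerm_apply, SemidirectProduct.mul_left,
      SemidirectProduct.mul_right, sgnRep_apply_eq_zpow, QuotientGroup.mk_mul, QuotientGroup.mk_zpow, Units.val_mul,
      mul_zpow, ← zpow_mul, mul_comm (d'.right : ℤ), mul_assoc]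

/-! ## Inertia vectors of the cusps -/

/-- The INERTIA VECTOR of the cusp `q`: `e_{s(q)·h} − e_{s(q)·h⁻¹} ∈ U` (multiplicatively `e_{s(q)h} · e_{s(q)h⁻¹}⁻¹`), for
a section `s : T/ℤ·g → T` and `h ∈ T` (a square root of the chosen `a ∉ ℤ·g`) — a shifted DIFFERENCE of basis
vectors (print: the cusp classes of `X̲` satisfy ONE relation `Σ = 0`; here `Σ_q ivec q ↦ 0` in the coinvariants).
[cite: Mochizuki2012, IUTchI §1 p.37] -/
def ivec {g : Tors E Fbar l} (s : Tors E Fbar l ⧸ Subgroup.zpowers g → Tors E Fbar l) (h : Tors E Fbar l)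
    (q : Tors E Fbar l ⧸ Subgroup.zpowers g) : U E Fbar l :=
  U.e (s q * h) * (U.e (s q * h⁻¹))⁻¹

/-- The inertia vector as an element of the finite factor `DihU` (inside `Del ⋊ 1`, `U`-part only).
[cite: Mochizuki2012, IUTchI §1 p.37] -/
def igen {g : Tors E Fbar l} (s : Tors E Fbar l ⧸ Subgroup.zpowers g → Tors E Fbar l) (h : Tors E Fbar l)
    (q : Tors E Fbar l ⧸ Subgroup.zpowers g) : DihU F E Fbar l :=
  SemidirectProduct.inl (SemidirectProduct.inl (ivec s h q))

/-- [cite: Mochizuki2012, IUTchI §1 p.37] -/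
@[simp] theorem igen_right {g : Tors E Fbar l} (s : Tors E Fbar l ⧸ Subgroup.zpowers g → Tors E Fbar l) (h : Tors E Fbar l)
    (q : Tors E Fbar l ⧸ Subgroup.zpowers g) : (igen (F := F) s h q).right = 1 := rfl

/-- [cite: Mochizuki2012, IUTchI §1 p.37] -/
@[simp] theorem igen_left_right {g : Tors E Fbar l} (s : Tors E Fbar l ⧸ Subgroup.zpowers g → Tors E Fbar l) (h : Tors E Fbar l)
    (q : Tors E Fbar l ⧸ Subgroup.zpowers g) : (igen (F := F) s h q).left.right = 1 := rfl

/-- [cite: Mochizuki2012, IUTchI §1 p.37] -/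
@[simp] theorem igen_left_left {g : Tors E Fbar l} (s : Tors E Fbar l ⧸ Subgroup.zpowers g → Tors E Fbar l) (h : Tors E Fbar l)
    (q : Tors E Fbar l ⧸ Subgroup.zpowers g) : (igen (F := F) s h q).left.left = ivec s h q := rfl

/-! ## The `K`-level data `Π_{C_K} := G × DihU` over a profinite `G` (for `G := G_K`) -/

/-- `G × D ⊆ G × DihU` for a subgroup `D` of the finite factor. [cite: Mochizuki2012, IUTchI §1 p.37] -/
def liftU (G : Type u) [Group G] (D : Subgroup (DihU F E Fbar l)) : Subgroup (G × DihU F E Fbar l) :=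
  D.comap (MonoidHom.snd G (DihU F E Fbar l))

/-- [cite: Mochizuki2012, IUTchI §1 p.37] -/
@[simp] theorem mem_liftU {G : Type u} [Group G] {D : Subgroup (DihU F E Fbar l)} {x : G × DihU F E Fbar l} :
    x ∈ liftU G D ↔ x.2 ∈ D := Iff.rfl

/-- `[G × DihU : G × D] = [DihU : D]`. [cite: Mochizuki2012, IUTchI §1 p.37] -/
theorem liftU_index (G : Type u) [Group G] (D : Subgroup (DihU F E Fbar l)) : (liftU G D).index = D.index :=
  Subgroup.index_comap_of_surjective D Prod.snd_surjective

/-- Relative indices of lifted subgroups are computed in the finite factor. [cite: Mochizuki2012, IUTchI §1 p.37] -/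
theorem liftU_relIndex (G : Type u) [Group G] (D D' : Subgroup (DihU F E Fbar l)) :
    (liftU G D).relIndex (liftU G D') = D.relIndex D' := by
  rw [liftU, liftU, Subgroup.relIndex_comap, Subgroup.map_comap_eq_self_of_surjective Prod.snd_surjective]

/-- [cite: Mochizuki2012, IUTchI §1 p.37] -/
theorem liftU_inf (G : Type u) [Group G] (D D' : Subgroup (DihU F E Fbar l)) :
    liftU G (D ⊓ D') = liftU G D ⊓ liftU G D' :=
  Subgroup.comap_inf D D' _

/-- [cite: Mochizuki2012, IUTchI §1 p.37] -/
theorem liftU_mono (G : Type u) [Group G] {D D' : Subgroup (DihU F E Fbar l)} (h : D ≤ D') : liftU G D ≤ liftU G D' :=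
  Subgroup.comap_mono h

/-- `G × D ↠ G`. [cite: Mochizuki2012, IUTchI §1 p.37] -/
theorem fst_liftU_surjective (G : Type u) [Group G] (D : Subgroup (DihU F E Fbar l)) :
    Function.Surjective ((MonoidHom.fst G (DihU F E Fbar l)).comp (liftU G D).subtype) :=
  fun g => ⟨⟨(g, 1), by simp⟩, rfl⟩

/-- `G × D` is open (the finite factor is discrete). [cite: Mochizuki2012, IUTchI §1 p.37] -/
theorem isOpen_liftU (G : Type u) [Group G] [TopologicalSpace G] (D : Subgroup (DihU F E Fbar l)) :
    IsOpen (liftU G D : Set (G × DihU F E Fbar l)) :=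
  (isOpen_discrete (D : Set (DihU F E Fbar l))).preimage continuous_snd

variable (F E Fbar l)
variable (G : Type u) [Group G] [TopologicalSpace G] [IsTopologicalGroup G] [CompactSpace G]
  [TotallyDisconnectedSpace G] [E.IsElliptic] [NeZero l]

/-- `Π_{C_K} := G × DihU ↠ G` as a `FundamentalExtension`. [cite: Mochizuki2012, IUTchI Def 3.1 (d) p.62] -/
def extK₃ : FundamentalExtension.{u} where
  arith := ProfiniteGrp.of (G × DihU F E Fbar l)
  gal := ProfiniteGrp.of G
  aug := ContinuousMonoidHom.fst G (DihU F E Fbar l)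
  aug_surjective := Prod.fst_surjective

/-- **The `K`-level §1 datum of the model** ([IUTchI] §1 `PuncturedEllipticData` over `G = G_K`): `Π_C := G × DihU`,
`Π_X := G × dX`, `Π_{C̲} := G × dC g`, the `l` cusps `E_F[l]/ℤ·g` with decomposition groups `D_q := G × ⟨igen q⟩`
(`s` a section of `E_F[l] ↠ E_F[l]/ℤ·g`, `h` with `h² = a ∉ ℤ·g`), `ε⁰ := [1]`, `ε′ := [a]`, `ε″ := [a]⁻¹`, `2ε := [a]²`;
(∗) holds because commutators of `Π_X` lie in `⁅Δ_X, Δ_X⁆`. [cite: Mochizuki2012, IUTchI §1 p.37] -/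
def pedOf₃ (g : Tors E Fbar l) (s : Tors E Fbar l ⧸ Subgroup.zpowers g → Tors E Fbar l) (h a : Tors E Fbar l)
    (hl : l.Prime) (ha : a ∉ Subgroup.zpowers g) (h5 : 5 ≤ l) (h6 : l.Coprime 6) : PuncturedEllipticData.{u} :=
  haveI : Fact l.Prime := ⟨hl⟩
  let abar : Tors E Fbar l ⧸ Subgroup.zpowers g := QuotientGroup.mk a
  have habar : abar ≠ 1 := fun h1 => ha ((QuotientGroup.eq_one_iff a).mp h1)
  have hpow : abar ^ l = 1 := by rw [← QuotientGroup.mk_pow, Tors.pow_l, QuotientGroup.mk_one]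
  have hord : orderOf abar = l := orderOf_eq_prime hpow habar
  have hdvd : ∀ n : ℕ, abar ^ n = 1 → l ∣ n := fun n hn => hord ▸ orderOf_dvd_of_pow_eq_one hn
  { l := l
    five_le := h5
    coprime_six := h6
    E := extK₃ F E Fbar l G
    PiX := liftU G (dX F E Fbar l)
    PiCbar := liftU G (dC F E g)
    isOpen_piX := isOpen_liftU G _
    isOpen_piCbar := isOpen_liftU G _
    index_piX := (liftU_index G _).trans (dX_index (F := F) (E := E) (Fbar := Fbar) (l := l))
    aug_piX := fst_liftU_surjective G _
    aug_piCbar := fst_liftU_surjective G _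
    star := by
      intro g' hg' x hx
      refine Subgroup.le_topologicalClosure _ (Subgroup.mem_sup_left ?_)
      have hx1 : x.1 = 1 := (FundamentalExtension.mem_geom _).mp hx.2
      let g₁ : (extK₃ F E Fbar l G).arith := ((1 : G), g'.2)
      have h1 : g₁ ∈ liftU G (dX F E Fbar l) ⊓ (extK₃ F E Fbar l G).geom :=
        ⟨hg', (FundamentalExtension.mem_geom _).mpr rfl⟩
      have heq : g' * x * g'⁻¹ * x⁻¹ = g₁ * x * g₁⁻¹ * x⁻¹ := by
        refine Prod.ext ?_ rfl
        show g'.1 * x.1 * g'.1⁻¹ * x.1⁻¹ = 1 * x.1 * 1⁻¹ * x.1⁻¹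
        simp [hx1]
      rw [heq, ← commutatorElement_def]
      exact Subgroup.commutator_mem_commutator h1 hx
    Cusp := Tors E Fbar l ⧸ Subgroup.zpowers g
    decomp := fun q => liftU G (Subgroup.zpowers (igen (F := F) s h q))
    decomp_le := fun q => le_inf
      (liftU_mono G (Subgroup.zpowers_le.mpr
        (show igen (F := F) s h q ∈ dX F E Fbar l from (mem_dX_iff _).mpr rfl)))
      (liftU_mono G (Subgroup.zpowers_le.mpr
        (show igen (F := F) s h q ∈ dC F E g from by rw [mem_dC_iff, igen_left_right]; exact one_mem _)))
    ε0 := 1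
    ε1 := abar
    ε2 := abar⁻¹
    twoε := abar ^ 2
    ε1_ne_ε0 := habar
    ε2_ne_ε0 := inv_ne_one.mpr habar
    ε1_ne_ε2 := by
      intro h12
      have h2 : abar ^ 2 = 1 := by
        calc abar ^ 2 = abar * abar⁻¹ := by rw [pow_two, ← h12]
          _ = 1 := mul_inv_cancel abar
      have := Nat.le_of_dvd two_pos (hdvd 2 h2); omega
    twoε_ne := by
      refine ⟨fun h2 => ?_, fun h21 => ?_, fun h22 => ?_⟩
      · have := Nat.le_of_dvd two_pos (hdvd 2 h2); omega
      · apply habar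
        have : abar ^ 2 = abar ^ 1 := by rw [h21, pow_one]
        rw [pow_two, pow_one] at this
        exact mul_left_cancel (a := abar) (by rw [this, mul_one])
      · have h3 : abar ^ 3 = 1 := by rw [pow_succ, h22, inv_mul_cancel]
        have := Nat.le_of_dvd three_pos (hdvd 3 h3); omega
    aug_decomp_twoε := fst_liftU_surjective G _ }

end TorsionCuspModel

end Literature.IUT.HodgeTheaters

end
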